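import Summits.QuantumFields.BalabanUV.Beta.KernelWardHColumnWall
import Summits.QuantumFields.BalabanUV.Beta.KernelWardMColumn
import Summits.QuantumFields.BalabanUV.Beta.GAN24.CoDressedColumnSourceSums
import Summits.QuantumFields.BalabanUV.Beta.GAN24.MultiplierZeroMass
import Summits.QuantumFields.BalabanUV.Beta.GAN24.SymLinKernelFaceSupport

/-!
# `BalabanUV.Beta.GAN24.CoarseGaugeSourceResponse` — binder row G-an2-4 ∕ (CONV-C), the (S) row ∕ (W-γ) AT EVERY LEVEL («the Δ_j-exact charge tower», road-P2 gen 41,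
# memo `HOME/b2b-balaban-gan24-p2/gen41/W-GAMMA-TOWER-v0.md`, hinge (I2)): **THE CO-DRESSED STEP RESOLVENT'S RESPONSE TO A COARSE PURE-GAUGE SOURCE IS THE FINE PURE
# GAUGE OF ITS BLOCK LIFT — AT EVERY LEVEL `j`, EVERY IN-BLOCK ROOT; HENCE A MULTIPLIER SOURCE DEPENDING ON ONE COORDINATE IS ANSWERED ON THE EXIT BONDS OF ITS
# SLABS ONLY, AND NOT AT ALL ON THE MULTIPLIER LEGS**

NOT IN PRINT; OUR BOOKKEEPING ([folklore] `tsum` bookkeeping — one shift of the coarse source index and two one-point sums — over d1-leaf-07's column Ward law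
`KernelWardHColumnWall.colH_ward_KInvStep_all` (`Σ_μ (colH G_j Lc μ (y − e_μ) κ u − colH G_j Lc μ y κ u) = (stepScale_j·Lc^{d+1})⁻¹·gaugeWt Lc y κ u`), an1's
`KernelWardMColumn.colM_coDressKBmAt_KInvStep_ward` (the multiplier-column twin, right side `0`), the source summabilities of leaf-02 g51
(`CoDressedColumnSourceSums.summable_source_colH_coDressKBmAt` over `LinT2ZeroModeStep.hasSum_KInvStep_col`) and gan24-leaf-14 (`MultiplierZeroMass.hasSum_KInvStep_mm_right`),
and leaf-02's integer lemma `SymLinKernelFaceSupport.int_ediv_add_one`; 0 `def`, 0 cited fact, 0 `def … : Prop`, 0 sorry).  HONEST FRAMING (cell contract, verbatim):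
«discharging `BetaPertH` makes Bałaban's UV stability UNCONDITIONAL — a real constructive-QFT result; it is NOT the continuum limit and NOT the Clay problem.»  HONEST
DEPENDENCY (verbatim): «continuum YM on T⁴ ⇐ BetaPertH ∧ nine spine estimates (0/9 proved); BetaPertH ⇐ (D1) ∧ (D4) ∧ CAP+tail; G-an2-4 gates asym, D1 and NE2/3/4.»

SETTING.  `G_j := coDressKBmAt (toSite r) Lc (KInvStep Lc j)` (the wall family's co-dressed step resolvent, `SpineRecursiveW`), `colH G_j Lc μ y κ u = G_j u (Lc•y) (inl κ) (inr μ)`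
(the fine field leg `(κ,u)` of the response to the unit multiplier source at the coarse bond `(μ,y)`), `colM G_j Lc μ y ρ′ w` the multiplier leg `(ρ′, Lc•w)` of the same response,
`cH_j := (stepScale d Lc j · Lc^{d+1})⁻¹`.  A coarse SOURCE PATTERN is a function `h : (μ,y) ↦ ℝ`; the response is `Σ_μ Σ'_y h(μ,y)·colH G_j Lc μ y κ u`.
* §1 `tsum` algebra: `summable_bdd_mul` (bounded × summable), `tsum_mul_ite_eq'` (one-point sums), **`tsum_mul_coarseDiv_eq`** (summation by parts on `ℤ^{d+1}`:
  `Σ'_y φ(y)·Σ_μ (c μ (y − e_μ) − c μ y) = Σ_μ Σ'_y (φ(y + e_μ) − φ(y))·c μ y` for bounded `φ` and summable columns `c μ`).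
* §2 **`sum_tsum_coarseGrad_colH`** (EVERY `j`, every in-block root, every bounded `φ : Site → ℝ`):
  `Σ_μ Σ'_y (φ(y+e_μ) − φ(y))·colH G_j Lc μ y κ u = cH_j·(φ(blk Lc (u+e_κ)) − φ(blk Lc u))` — THE RESPONSE TO THE COARSE PURE-GAUGE SOURCE `d_c φ` IS THE FINE PURE GAUGE
  `cH_j·d(φ ∘ blk)`; **`sum_tsum_coarseGrad_colM`**: the same response has NO multiplier legs (`= 0`).
* §3 SINGLE-COORDINATE SOURCES (direction `a`, bounded `Φ : ℤ → ℝ`): `blk_add_unitVec_apply` (`(blk (u+e_κ))_a = (blk u)_a + 𝟙[κ = a ∧ u_a % Lc = Lc−1]`),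
  **`tsum_coordGrad_colH`** (`Σ'_y (Φ(y_a+1) − Φ(y_a))·colH G_j Lc a y κ u = cH_j·𝟙[κ = a ∧ u_a % Lc = Lc−1]·(Φ((blk u)_a + 1) − Φ((blk u)_a))`), the SLAB instance
  **`tsum_slab_colH`** (`Σ'_y 𝟙[y_a = t]·colH G_j Lc a y κ u = cH_j·𝟙[κ = a ∧ u_a % Lc = Lc−1 ∧ (blk u)_a = t]` — a multiplier source constant on the coarse hyperplane
  `y_a = t` of `a`-bonds is answered on the EXIT `a`-bonds of the fine slab `⌊u_a∕Lc⌋ = t` with the level constant `cH_j`, nowhere else), `tsum_slab_colM` (`= 0`), and the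
  transverse vanishing `tsum_slab_colH_of_ne` (`κ ≠ a`: `0`).
* §4 BOUNDED single-coordinate sources `y ↦ f(y_a)` (the periodic classes `𝟙[· % Lc^m = Lc^m − 1]` of the tower): `tsum_coord_fibre` (fibration over `y_a`),
  **`tsum_coord_colH`** (`Σ'_y f(y_a)·colH G_j Lc a y κ u = cH_j·𝟙[κ = a ∧ u_a % Lc = Lc−1]·f((blk u)_a)` — the response is the closed form `cH_j·f(⌊u_a∕Lc⌋)·exit_a`), `tsum_coord_colM` (`= 0`).
ENGINE (road-P2 E28 = kit j166124, D = 2, n = 3, jb = 0, Bc = 3; float64 DIAG-ONLY): `c = 0.111111 = 3⁻² = cH_0` on every slab, residual ≤ 1.1e-15, multiplier part ≤ 2.8e-16.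
READING (why the tower needs it): by (I1) the level-(j+1) charge function of the pure S table against two leg weights `ω₁, ω₂` on its field legs is the level-`j` vertex read against the
two RESPONSES `G_j ω^M`; with §3 the level-(j+1) classes {plain, exit^{Lc}, exit^{Lc²}, …} (all of the form `y ↦ f(y_a)`) pull back to single-coordinate closed fine forms supported on
exit bonds — ONE class at all levels.  Asserts NO value of Bałaban's tables; a statement about the typed literal's resolvent only; discharges NOTHING of (W-γ) ∕ (INV) ∕ (S) ∕ (Q-R) ∕ (LT)
∕ (Q-L) ∕ (C) ∕ «T2Shape» ∕ «T2Drift» ∕ (hW, hWall); NEVER «G-an2-4 closed» as (CONV-C); NOT D1, NOT `BetaPertH`, NOT continuum, NOT Clay.  2026-08-22; no existing file touched.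
-/

noncomputable section

open Finset
open scoped BigOperators
open Literature.MathematicalPhysics.QuantumFieldTheory
open Literature.MathematicalPhysics.QuantumFieldTheory.Balaban1983to89
open Literature.MathematicalPhysics.QuantumFieldTheory.Balaban1983to89.Beta
open B6BondElimination (unitVec unitVec_apply)
open ExpKernelCalculus (Site MKer)
open AffineAveraging (box toSite)
open AveragingContours (blk)
open OneStepResolventKernel (Fib)
open OneStepKernelFamily (KInvStep colH)
open SecondOrderResponse (colM)
open Summit.QuantumFields.BalabanUV.Beta.AxialDressingRooted (coDressKBmAt)
open Summit.QuantumFields.BalabanUV.Beta.BorderedHessian (stepScale)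
open Summit.QuantumFields.BalabanUV.Beta.KernelWardRelative (gaugeWt)
open Summit.QuantumFields.BalabanUV.Beta.KernelWardHColumnWall (colH_ward_KInvStep_all)
open Summit.QuantumFields.BalabanUV.Beta.KernelWardMColumn (colM_coDressKBmAt colM_coDressKBmAt_KInvStep_ward)
open Summit.QuantumFields.BalabanUV.Beta.GAN24.CoDressedColumnSourceSums (summable_source_colH_coDressKBmAt)
open Summit.QuantumFields.BalabanUV.Beta.GAN24.LinT2ZeroModeStep (hasSum_KInvStep_col)
open Summit.QuantumFields.BalabanUV.Beta.GAN24.MultiplierZeroMass (hasSum_KInvStep_mm_right)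
open Summit.QuantumFields.BalabanUV.Beta.GAN24.SymLinKernelFaceSupport (int_ediv_add_one)

namespace Summit.QuantumFields.BalabanUV.Beta.GAN24.CoarseGaugeSourceResponse

variable {d : ℕ}

/-! ## §1 `tsum` algebra on the coarse source index -/

/-- [folklore] Bounded × summable is summable (real series; summability over `ℝ` is absolute). -/
theorem summable_bdd_mul {ι : Type*} {c : ι → ℝ} (hc : Summable c) {φ : ι → ℝ} {B : ℝ} (hφ : ∀ i, |φ i| ≤ B) :
    Summable fun i => φ i * c i := by
  refine Summable.of_norm_bounded (g := fun i => B * |c i|) (hc.abs.mul_left B) fun i => ?_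
  rw [Real.norm_eq_abs, abs_mul]
  exact mul_le_mul_of_nonneg_right (hφ i) (abs_nonneg _)

/-- [folklore] A one-point sum: `Σ'_y φ y · 𝟙[b = y] = φ b`. -/
theorem tsum_mul_ite_eq' {ι : Type*} [DecidableEq ι] (φ : ι → ℝ) (b : ι) :
    ∑' y : ι, φ y * (if b = y then (1 : ℝ) else 0) = φ b := by
  have e : (fun y : ι => φ y * (if b = y then (1 : ℝ) else 0)) = fun y => if y = b then φ b else 0 := by
    funext y
    by_cases h : y = b
    · subst h; simp
    · rw [if_neg h, if_neg (Ne.symm h), mul_zero]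
  rw [e, tsum_ite_eq]

/-- [folklore] Shift of the summation index by a lattice vector: `Σ'_y F (y + e) = Σ'_y F y`. -/
theorem tsum_add_shift (F : Site (d + 1) → ℝ) (e : Site (d + 1)) : ∑' y : Site (d + 1), F (y + e) = ∑' y : Site (d + 1), F y :=
  (Equiv.addRight e).tsum_eq F

/-- [folklore] **SUMMATION BY PARTS ON THE COARSE SOURCE INDEX**: for columns `c μ : Site → ℝ` each summable and a BOUNDED weight `φ`,
`Σ'_y φ(y)·Σ_μ (c μ (y − e_μ) − c μ y) = Σ_μ Σ'_y (φ(y + e_μ) − φ(y))·c μ y` — the coarse DIVERGENCE pattern of the columns weighted by `φ` is the coarse GRADIENT of `φ`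
read against the columns. -/
theorem tsum_mul_coarseDiv_eq (c : Fin (d + 1) → Site (d + 1) → ℝ) (hc : ∀ μ, Summable (c μ)) (φ : Site (d + 1) → ℝ) {B : ℝ} (hφ : ∀ y, |φ y| ≤ B) :
    ∑' y : Site (d + 1), φ y * ∑ μ, (c μ (y - unitVec μ) - c μ y)
      = ∑ μ, ∑' y : Site (d + 1), (φ (y + unitVec μ) - φ y) * c μ y := by
  -- summability of the pieces
  have hs1 : ∀ μ, Summable fun y : Site (d + 1) => φ y * c μ (y - unitVec μ) := fun μ =>
    summable_bdd_mul ((Equiv.subRight (unitVec μ)).summable_iff.mpr (hc μ)) hφ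
  have hs2 : ∀ μ, Summable fun y : Site (d + 1) => φ y * c μ y := fun μ => summable_bdd_mul (hc μ) hφ
  have hs3 : ∀ μ, Summable fun y : Site (d + 1) => φ (y + unitVec μ) * c μ y := fun μ =>
    summable_bdd_mul (hc μ) (fun y => hφ (y + unitVec μ))
  have e1 : (fun y : Site (d + 1) => φ y * ∑ μ, (c μ (y - unitVec μ) - c μ y))
      = fun y => ∑ μ, (φ y * c μ (y - unitVec μ) - φ y * c μ y) := by
    funext y; rw [Finset.mul_sum]; exact Finset.sum_congr rfl fun μ _ => by ring
  rw [e1, Summable.tsum_finsetSum (fun μ _ => (hs1 μ).sub (hs2 μ))]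
  refine Finset.sum_congr rfl fun μ _ => ?_
  rw [Summable.tsum_sub (hs1 μ) (hs2 μ)]
  have e2 : ∑' y : Site (d + 1), φ y * c μ (y - unitVec μ) = ∑' y : Site (d + 1), φ (y + unitVec μ) * c μ y := by
    rw [← tsum_add_shift (fun y => φ y * c μ (y - unitVec μ)) (unitVec μ)]
    exact tsum_congr fun y => by rw [add_sub_cancel_right]
  rw [e2, ← Summable.tsum_sub (hs3 μ) (hs2 μ)]
  exact tsum_congr fun y => by ring

/-! ## §2 The response of the co-dressed step resolvent to a coarse pure-gauge source, every level -/

section Step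

variable {Lc : ℕ} [NeZero Lc] {r : Fin (d + 1) → ℕ}

/-- [folklore] The source series of the co-dressed column is summable (leaf-02 g51 over `hasSum_KInvStep_col`). -/
theorem summable_source_colH (r : Fin (d + 1) → ℕ) (j : ℕ) (μ κ : Fin (d + 1)) (u : Site (d + 1)) :
    Summable fun y : Site (d + 1) => colH (coDressKBmAt (toSite r) Lc (KInvStep (d := d) Lc j)) Lc μ y κ u :=
  summable_source_colH_coDressKBmAt r (K := KInvStep (d := d) Lc j) (N := Lc)
    (fun u κ' μ => hasSum_KInvStep_col (d := d) (Lc := Lc) j u κ' μ) μ κ u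

omit [NeZero Lc] in
/-- [folklore] `Σ'_y φ(y)·gaugeWt Lc y κ u = φ(blk (u + e_κ)) − φ(blk u)` (the pure-gauge weight is a difference of two one-point indicators in `y`). -/
theorem tsum_mul_gaugeWt (φ : Site (d + 1) → ℝ) (κ : Fin (d + 1)) (u : Site (d + 1)) :
    ∑' y : Site (d + 1), φ y * gaugeWt Lc y κ u = φ (blk Lc (u + unitVec κ)) - φ (blk Lc u) := by
  classical
  have e : (fun y : Site (d + 1) => φ y * gaugeWt Lc y κ u)
      = fun y => φ y * (if blk Lc (u + unitVec κ) = y then (1 : ℝ) else 0) - φ y * (if blk Lc u = y then (1 : ℝ) else 0) := by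
    funext y; simp only [gaugeWt]; ring
  have h1 : Summable fun y : Site (d + 1) => φ y * (if blk Lc (u + unitVec κ) = y then (1 : ℝ) else 0) := by
    refine summable_of_ne_finset_zero (s := {blk Lc (u + unitVec κ)}) fun y hy => ?_
    rw [Finset.mem_singleton] at hy
    rw [if_neg (Ne.symm hy), mul_zero]
  have h2 : Summable fun y : Site (d + 1) => φ y * (if blk Lc u = y then (1 : ℝ) else 0) := by
    refine summable_of_ne_finset_zero (s := {blk Lc u}) fun y hy => ?_
    rw [Finset.mem_singleton] at hy
    rw [if_neg (Ne.symm hy), mul_zero]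
  rw [e, Summable.tsum_sub h1 h2, tsum_mul_ite_eq', tsum_mul_ite_eq']

/-- NOT IN PRINT; OUR BOOKKEEPING.  **THE RESPONSE OF `G_j` TO A COARSE PURE-GAUGE SOURCE IS THE FINE PURE GAUGE OF ITS BLOCK LIFT** (every `j`, every in-block root,
every BOUNDED `φ : Site → ℝ`, every fine field leg `(κ,u)`):
`Σ_μ Σ'_y (φ(y + e_μ) − φ(y))·colH G_j Lc μ y κ u = (stepScale d Lc j·Lc^{d+1})⁻¹·(φ(blk Lc (u + e_κ)) − φ(blk Lc u))`
— summation by parts on the source index + d1-leaf-07's column Ward law `colH_ward_KInvStep_all` + the two one-point sums of `gaugeWt`. -/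
theorem sum_tsum_coarseGrad_colH (hr : r ∈ box (d + 1) Lc) (j : ℕ) (φ : Site (d + 1) → ℝ) {B : ℝ} (hφ : ∀ y, |φ y| ≤ B)
    (κ : Fin (d + 1)) (u : Site (d + 1)) :
    ∑ μ, ∑' y : Site (d + 1), (φ (y + unitVec μ) - φ y) * colH (coDressKBmAt (toSite r) Lc (KInvStep (d := d) Lc j)) Lc μ y κ u
      = (stepScale d Lc j * (Lc : ℝ) ^ (d + 1))⁻¹ * (φ (blk Lc (u + unitVec κ)) - φ (blk Lc u)) := by
  rw [← tsum_mul_coarseDiv_eq (fun μ y => colH (coDressKBmAt (toSite r) Lc (KInvStep (d := d) Lc j)) Lc μ y κ u)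
    (fun μ => summable_source_colH r j μ κ u) φ hφ]
  have e : ∀ y : Site (d + 1),
      φ y * ∑ μ, (colH (coDressKBmAt (toSite r) Lc (KInvStep (d := d) Lc j)) Lc μ (y - unitVec μ) κ u
        - colH (coDressKBmAt (toSite r) Lc (KInvStep (d := d) Lc j)) Lc μ y κ u)
      = (stepScale d Lc j * (Lc : ℝ) ^ (d + 1))⁻¹ * (φ y * gaugeWt Lc y κ u) := fun y => by
    rw [colH_ward_KInvStep_all hr j y κ u]; ring
  rw [tsum_congr e, tsum_mul_left, tsum_mul_gaugeWt]

/-- [folklore] The multiplier-leg source series of the co-dressed column is summable (it is the undressed one, `colM_coDressKBmAt`; gan24-leaf-14's `hasSum_KInvStep_mm_right`). -/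
theorem summable_source_colM (ρ : Site (d + 1)) (j : ℕ) (μ ρ' : Fin (d + 1)) (w : Site (d + 1)) :
    Summable fun y : Site (d + 1) => colM (coDressKBmAt ρ Lc (KInvStep (d := d) Lc j)) Lc μ y ρ' w := by
  have e : (fun y : Site (d + 1) => colM (coDressKBmAt ρ Lc (KInvStep (d := d) Lc j)) Lc μ y ρ' w)
      = fun y => KInvStep (d := d) Lc j (((Lc : ℕ) : ℤ) • w) (((Lc : ℕ) : ℤ) • y) (Sum.inr ρ') (Sum.inr μ) := by
    funext y; rw [colM_coDressKBmAt]; rfl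
  rw [e]
  exact (hasSum_KInvStep_mm_right (d := d) (Lc := Lc) j ρ' μ (((Lc : ℕ) : ℤ) • w)).summable

/-- NOT IN PRINT; OUR BOOKKEEPING.  **THE SAME RESPONSE HAS NO MULTIPLIER LEGS**: `Σ_μ Σ'_y (φ(y + e_μ) − φ(y))·colM G_j Lc μ y ρ′ w = 0` (every `j`, any root, bounded `φ`) —
an1's multiplier-column Ward law `colM_coDressKBmAt_KInvStep_ward` (right side `0`). -/
theorem sum_tsum_coarseGrad_colM (ρ : Site (d + 1)) (j : ℕ) (φ : Site (d + 1) → ℝ) {B : ℝ} (hφ : ∀ y, |φ y| ≤ B) (ρ' : Fin (d + 1)) (w : Site (d + 1)) :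
    ∑ μ, ∑' y : Site (d + 1), (φ (y + unitVec μ) - φ y) * colM (coDressKBmAt ρ Lc (KInvStep (d := d) Lc j)) Lc μ y ρ' w = 0 := by
  rw [← tsum_mul_coarseDiv_eq (fun μ y => colM (coDressKBmAt ρ Lc (KInvStep (d := d) Lc j)) Lc μ y ρ' w)
    (fun μ => summable_source_colM ρ j μ ρ' w) φ hφ]
  have e : ∀ y : Site (d + 1),
      φ y * ∑ μ, (colM (coDressKBmAt ρ Lc (KInvStep (d := d) Lc j)) Lc μ (y - unitVec μ) ρ' w
        - colM (coDressKBmAt ρ Lc (KInvStep (d := d) Lc j)) Lc μ y ρ' w) = 0 := fun y => by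
    rw [colM_coDressKBmAt_KInvStep_ward ρ j y ρ' w, mul_zero]
  rw [tsum_congr e, tsum_zero]

/-! ## §3 Single-coordinate sources: slabs are answered on their exit bonds only -/

omit [NeZero Lc] in
/-- [folklore] The block label of `u + e_κ`, coordinate `a`: it moves by one exactly when `κ = a` and `u` sits on the exit face `u_a % Lc = Lc − 1` (leaf-02's `int_ediv_add_one`). -/
theorem blk_add_unitVec_apply (hLc : 1 ≤ Lc) (u : Site (d + 1)) (κ a : Fin (d + 1)) :
    blk Lc (u + unitVec κ) a = blk Lc u a + (if κ = a ∧ u a % (Lc : ℤ) = (Lc : ℤ) - 1 then 1 else 0) := by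
  simp only [AveragingContours.blk, Pi.add_apply, unitVec_apply]
  by_cases hκ : κ = a
  · subst hκ
    rw [if_pos rfl, int_ediv_add_one hLc]
    by_cases h : u κ % (Lc : ℤ) = (Lc : ℤ) - 1
    · rw [if_pos h, if_pos ⟨rfl, h⟩]
    · rw [if_neg h, if_neg (fun hh => h hh.2)]
  · rw [if_neg (fun hh => hκ hh.symm), add_zero, if_neg (fun hh => hκ hh.1), add_zero]

/-- NOT IN PRINT; OUR BOOKKEEPING.  **A COARSE SOURCE DEPENDING ON ONE COORDINATE IS ANSWERED ON EXIT BONDS ONLY** (every `j`, in-block root, direction `a`, bounded `Φ : ℤ → ℝ`):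
`Σ'_y (Φ(y_a + 1) − Φ(y_a))·colH G_j Lc a y κ u = cH_j·𝟙[κ = a ∧ u_a % Lc = Lc − 1]·(Φ((blk u)_a + 1) − Φ((blk u)_a))` — §2 at `φ = Φ ∘ (·)_a` (only `μ = a` contributes). -/
theorem tsum_coordGrad_colH (hr : r ∈ box (d + 1) Lc) (j : ℕ) (a : Fin (d + 1)) (Φ : ℤ → ℝ) {B : ℝ} (hΦ : ∀ s, |Φ s| ≤ B) (κ : Fin (d + 1)) (u : Site (d + 1)) :
    ∑' y : Site (d + 1), (Φ (y a + 1) - Φ (y a)) * colH (coDressKBmAt (toSite r) Lc (KInvStep (d := d) Lc j)) Lc a y κ u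
      = (stepScale d Lc j * (Lc : ℝ) ^ (d + 1))⁻¹ *
          (if κ = a ∧ u a % (Lc : ℤ) = (Lc : ℤ) - 1 then Φ (blk Lc u a + 1) - Φ (blk Lc u a) else 0) := by
  have hLc : 1 ≤ Lc := Nat.one_le_iff_ne_zero.mpr (NeZero.ne Lc)
  have h := sum_tsum_coarseGrad_colH hr j (fun y : Site (d + 1) => Φ (y a)) (fun y => hΦ (y a)) κ u
  -- only the direction `μ = a` survives on the left
  rw [Finset.sum_eq_single a (fun μ _ hμ => ?_) (fun h => absurd (Finset.mem_univ a) h)] at h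
  · have e : ∀ y : Site (d + 1), Φ ((y + unitVec a) a) - Φ (y a) = Φ (y a + 1) - Φ (y a) := fun y => by
      simp only [Pi.add_apply, unitVec_apply, if_true]
    simp only [e] at h
    rw [h, blk_add_unitVec_apply hLc u κ a]
    by_cases hc : κ = a ∧ u a % (Lc : ℤ) = (Lc : ℤ) - 1
    · rw [if_pos hc, if_pos hc]
    · rw [if_neg hc, if_neg hc, add_zero, sub_self]
  · have e : ∀ y : Site (d + 1), Φ ((y + unitVec μ) a) - Φ (y a) = 0 := fun y => by
      simp only [Pi.add_apply, unitVec_apply, if_neg (Ne.symm hμ), add_zero, sub_self]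
    simp only [e, zero_mul, tsum_zero]

/-- NOT IN PRINT; OUR BOOKKEEPING.  **THE SLAB RESPONSE** (every `j`, in-block root, direction `a`, coarse height `t`): the unit multiplier source on ALL `a`-bonds of the coarse
hyperplane `y_a = t` is answered by `G_j` on the field leg `(κ,u)` with `cH_j·𝟙[κ = a ∧ u_a % Lc = Lc − 1 ∧ (blk u)_a = t]` — the EXIT `a`-bonds of the fine slab `⌊u_a∕Lc⌋ = t`,
constant `cH_j = (stepScale_j·Lc^{d+1})⁻¹`, nothing inside the slab, nothing on transverse bonds (road-P2 E28: `c = 3⁻²` at D = 2, jb = 0, residual ≤ 1.1e-15). -/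
theorem tsum_slab_colH (hr : r ∈ box (d + 1) Lc) (j : ℕ) (a : Fin (d + 1)) (t : ℤ) (κ : Fin (d + 1)) (u : Site (d + 1)) :
    ∑' y : Site (d + 1), (if y a = t then (1 : ℝ) else 0) * colH (coDressKBmAt (toSite r) Lc (KInvStep (d := d) Lc j)) Lc a y κ u
      = (stepScale d Lc j * (Lc : ℝ) ^ (d + 1))⁻¹ *
          (if κ = a ∧ u a % (Lc : ℤ) = (Lc : ℤ) - 1 ∧ blk Lc u a = t then 1 else 0) := by
  -- the slab indicator is the coordinate gradient of the bounded step `Φ = 𝟙[t < ·]`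
  have hΦ : ∀ s : ℤ, |(fun s : ℤ => if t < s then (1 : ℝ) else 0) s| ≤ 1 := fun s => by
    dsimp only; split_ifs <;> simp
  have h := tsum_coordGrad_colH hr j a (fun s : ℤ => if t < s then (1 : ℝ) else 0) hΦ κ u
  have e : ∀ s : ℤ, ((if t < s + 1 then (1 : ℝ) else 0) - (if t < s then (1 : ℝ) else 0)) = if s = t then (1 : ℝ) else 0 := fun s => by
    by_cases h1 : s = t
    · subst h1; simp
    · by_cases h2 : t < s
      · rw [if_pos (by omega), if_pos h2, if_neg h1, sub_self]
      · rw [if_neg (by omega), if_neg h2, if_neg h1, sub_self]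
  simp only [e] at h
  rw [h]
  congr 1
  by_cases hc : κ = a ∧ u a % (Lc : ℤ) = (Lc : ℤ) - 1
  · rw [if_pos hc]
    by_cases ht : blk Lc u a = t
    · rw [if_pos ht, if_pos ⟨hc.1, hc.2, ht⟩]
    · rw [if_neg ht, if_neg (fun hh => ht hh.2.2)]
  · rw [if_neg hc, if_neg (fun hh => hc ⟨hh.1, hh.2.1⟩)]

/-- NOT IN PRINT; OUR BOOKKEEPING.  On a TRANSVERSE field leg (`κ ≠ a`) the slab response vanishes. -/
theorem tsum_slab_colH_of_ne (hr : r ∈ box (d + 1) Lc) (j : ℕ) {a κ : Fin (d + 1)} (hκ : κ ≠ a) (t : ℤ) (u : Site (d + 1)) :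
    ∑' y : Site (d + 1), (if y a = t then (1 : ℝ) else 0) * colH (coDressKBmAt (toSite r) Lc (KInvStep (d := d) Lc j)) Lc a y κ u = 0 := by
  rw [tsum_slab_colH hr j a t κ u, if_neg (fun hh => hκ hh.1), mul_zero]

/-- NOT IN PRINT; OUR BOOKKEEPING.  Inside the slab (off the exit face, `u_a % Lc ≠ Lc − 1`) the slab response vanishes. -/
theorem tsum_slab_colH_of_not_exit (hr : r ∈ box (d + 1) Lc) (j : ℕ) (a : Fin (d + 1)) (t : ℤ) (κ : Fin (d + 1)) {u : Site (d + 1)}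
    (hu : u a % (Lc : ℤ) ≠ (Lc : ℤ) - 1) :
    ∑' y : Site (d + 1), (if y a = t then (1 : ℝ) else 0) * colH (coDressKBmAt (toSite r) Lc (KInvStep (d := d) Lc j)) Lc a y κ u = 0 := by
  rw [tsum_slab_colH hr j a t κ u, if_neg (fun hh => hu hh.2.1), mul_zero]

/-- NOT IN PRINT; OUR BOOKKEEPING.  **THE SLAB SOURCE HAS NO MULTIPLIER-LEG RESPONSE**: `Σ'_y 𝟙[y_a = t]·colM G_j Lc a y ρ′ w = 0` (every `j`, any root). -/
theorem tsum_slab_colM (ρ : Site (d + 1)) (j : ℕ) (a : Fin (d + 1)) (t : ℤ) (ρ' : Fin (d + 1)) (w : Site (d + 1)) :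
    ∑' y : Site (d + 1), (if y a = t then (1 : ℝ) else 0) * colM (coDressKBmAt ρ Lc (KInvStep (d := d) Lc j)) Lc a y ρ' w = 0 := by
  have hΦ : ∀ y : Site (d + 1), |(fun y : Site (d + 1) => if t < y a then (1 : ℝ) else 0) y| ≤ 1 := fun y => by
    dsimp only; split_ifs <;> simp
  have h := sum_tsum_coarseGrad_colM (Lc := Lc) ρ j (fun y : Site (d + 1) => if t < y a then (1 : ℝ) else 0) hΦ ρ' w
  rw [Finset.sum_eq_single a (fun μ _ hμ => ?_) (fun h => absurd (Finset.mem_univ a) h)] at h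
  · have e : ∀ y : Site (d + 1), ((if t < (y + unitVec a) a then (1 : ℝ) else 0) - (if t < y a then (1 : ℝ) else 0))
        = if y a = t then (1 : ℝ) else 0 := fun y => by
      simp only [Pi.add_apply, unitVec_apply, if_true]
      by_cases h1 : y a = t
      · rw [h1]; simp
      · by_cases h2 : t < y a
        · rw [if_pos (by omega), if_pos h2, if_neg h1, sub_self]
        · rw [if_neg (by omega), if_neg h2, if_neg h1, sub_self]
    simp only [e] at h
    exact h
  · have e : ∀ y : Site (d + 1), ((if t < (y + unitVec μ) a then (1 : ℝ) else 0) - (if t < y a then (1 : ℝ) else 0)) = 0 := fun y => by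
      simp only [Pi.add_apply, unitVec_apply, if_neg (Ne.symm hμ), add_zero, sub_self]
    simp only [e, zero_mul, tsum_zero]

/-! ## §4 Bounded single-coordinate sources (the periodic classes of the tower: `f = 𝟙[· % Lc^m = Lc^m − 1]`, …) -/

/-- [folklore] Fibration of a weighted source sum over the `a`-th coordinate: for a summable `c` and bounded `f`,
`Σ'_y f(y_a)·c y = Σ'_t f(t)·Σ'_y 𝟙[y_a = t]·c y` (the injection `y ↦ (y_a, y)` into `ℤ × Site`, `tsum_prod'`). -/
theorem tsum_coord_fibre (c : Site (d + 1) → ℝ) (hc : Summable c) (a : Fin (d + 1)) (f : ℤ → ℝ) {B : ℝ} (hf : ∀ s, |f s| ≤ B) :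
    ∑' y : Site (d + 1), f (y a) * c y = ∑' t : ℤ, f t * ∑' y : Site (d + 1), (if y a = t then (1 : ℝ) else 0) * c y := by
  classical
  set F : ℤ × Site (d + 1) → ℝ := fun p => f p.1 * ((if p.2 a = p.1 then (1 : ℝ) else 0) * c p.2) with hF
  set g : Site (d + 1) → ℤ × Site (d + 1) := fun y => (y a, y) with hg
  have hginj : Function.Injective g := fun y y' h => (Prod.ext_iff.mp h).2
  have hF0 : ∀ p, p ∉ Set.range g → F p = 0 := by
    rintro ⟨t, y⟩ hp
    have hne : y a ≠ t := fun h => hp ⟨y, Prod.ext h rfl⟩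
    simp only [hF, if_neg hne, zero_mul, mul_zero]
  have hsupp : Function.support F ⊆ Set.range g := fun p hp => by
    by_contra hq
    exact hp (hF0 p hq)
  have hFg : F ∘ g = fun y => f (y a) * c y := by
    funext y; simp only [Function.comp, hF, hg, if_true, one_mul]
  have hsum : Summable F := (hginj.summable_iff hF0).mp (by rw [hFg]; exact summable_bdd_mul hc (fun y => hf (y a)))
  have hfib : ∀ t : ℤ, Summable fun y : Site (d + 1) => F (t, y) := fun t => by
    have h1 : Summable fun y : Site (d + 1) => (if y a = t then (1 : ℝ) else 0) * c y :=
      summable_bdd_mul hc (B := 1) (fun y => by split_ifs <;> simp)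
    simpa only [hF] using h1.mul_left (f t)
  calc ∑' y : Site (d + 1), f (y a) * c y = ∑' y, F (g y) := by rw [← hFg]; rfl
    _ = ∑' p, F p := hginj.tsum_eq hsupp
    _ = ∑' t : ℤ, ∑' y : Site (d + 1), F (t, y) := hsum.tsum_prod' hfib
    _ = ∑' t : ℤ, f t * ∑' y : Site (d + 1), (if y a = t then (1 : ℝ) else 0) * c y :=
        tsum_congr fun t => by simp only [hF]; rw [tsum_mul_left]

/-- NOT IN PRINT; OUR BOOKKEEPING.  **A BOUNDED SINGLE-COORDINATE SOURCE IS ANSWERED ON EXIT BONDS ONLY, WITH ITS OWN VALUE ON THE SLAB** (every `j`, in-block root, direction `a`,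
bounded `f : ℤ → ℝ` — e.g. the coarse exit indicator `𝟙[· % Lc = Lc−1]` of the next level, or `𝟙[· % Lc^m = Lc^m − 1]`):
`Σ'_y f(y_a)·colH G_j Lc a y κ u = cH_j·𝟙[κ = a ∧ u_a % Lc = Lc − 1]·f((blk u)_a)` — the fine response is the closed single-coordinate form `cH_j·f(⌊u_a∕Lc⌋)·exit_a`. -/
theorem tsum_coord_colH (hr : r ∈ box (d + 1) Lc) (j : ℕ) (a : Fin (d + 1)) (f : ℤ → ℝ) {B : ℝ} (hf : ∀ s, |f s| ≤ B) (κ : Fin (d + 1)) (u : Site (d + 1)) :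
    ∑' y : Site (d + 1), f (y a) * colH (coDressKBmAt (toSite r) Lc (KInvStep (d := d) Lc j)) Lc a y κ u
      = (stepScale d Lc j * (Lc : ℝ) ^ (d + 1))⁻¹ * (if κ = a ∧ u a % (Lc : ℤ) = (Lc : ℤ) - 1 then f (blk Lc u a) else 0) := by
  classical
  rw [tsum_coord_fibre _ (summable_source_colH r j a κ u) a f hf]
  simp_rw [tsum_slab_colH hr j a _ κ u]
  by_cases hc : κ = a ∧ u a % (Lc : ℤ) = (Lc : ℤ) - 1
  · have e : ∀ t : ℤ, f t * ((stepScale d Lc j * (Lc : ℝ) ^ (d + 1))⁻¹ * (if κ = a ∧ u a % (Lc : ℤ) = (Lc : ℤ) - 1 ∧ blk Lc u a = t then 1 else 0))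
        = if t = blk Lc u a then (stepScale d Lc j * (Lc : ℝ) ^ (d + 1))⁻¹ * f (blk Lc u a) else 0 := fun t => by
      by_cases ht : t = blk Lc u a
      · subst ht; rw [if_pos ⟨hc.1, hc.2, rfl⟩, if_pos rfl]; ring
      · rw [if_neg (fun hh => ht hh.2.2.symm), if_neg ht]; ring
    rw [tsum_congr e, tsum_ite_eq, if_pos hc]
  · have e : ∀ t : ℤ, f t * ((stepScale d Lc j * (Lc : ℝ) ^ (d + 1))⁻¹ * (if κ = a ∧ u a % (Lc : ℤ) = (Lc : ℤ) - 1 ∧ blk Lc u a = t then 1 else 0)) = 0 :=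
      fun t => by rw [if_neg (fun hh => hc ⟨hh.1, hh.2.1⟩)]; ring
    rw [tsum_congr e, tsum_zero, if_neg hc, mul_zero]

/-- NOT IN PRINT; OUR BOOKKEEPING.  **NO MULTIPLIER LEGS FOR BOUNDED SINGLE-COORDINATE SOURCES**: `Σ'_y f(y_a)·colM G_j Lc a y ρ′ w = 0` (every `j`, any root, bounded `f`). -/
theorem tsum_coord_colM (ρ : Site (d + 1)) (j : ℕ) (a : Fin (d + 1)) (f : ℤ → ℝ) {B : ℝ} (hf : ∀ s, |f s| ≤ B) (ρ' : Fin (d + 1)) (w : Site (d + 1)) :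
    ∑' y : Site (d + 1), f (y a) * colM (coDressKBmAt ρ Lc (KInvStep (d := d) Lc j)) Lc a y ρ' w = 0 := by
  rw [tsum_coord_fibre _ (summable_source_colM ρ j a ρ' w) a f hf]
  simp_rw [tsum_slab_colM ρ j a _ ρ' w, mul_zero, tsum_zero]

end Step

end Summit.QuantumFields.BalabanUV.Beta.GAN24.CoarseGaugeSourceResponse

end
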